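import Summits.BirchSwinnertonDyer.BirchSwinnertonDyer.Theorems.QuadraticBranchSignedControlPlusEtaLowerInclusionTamagawaRoadMordellWeilBrick
import HarnessLib

/-!
# Route `QuadraticBranchSignedControl` (rung K8, cell `bsd-potss`), crux `PlusEtaLowerInclusion`
# (item stmt-BirchSwinnertonDyer-19601): THE TAMAGAWA ROAD WITH THE MORDELL–WEIL CLASSES, part 2 —
# the `p*`-twist count `∏_T p^{ord_p c_ℓ(W)} · #κ_{p^m}(W(ℚ)) ∣ #Sel^{loc,∞,+}(W/ℚ)[p^m]`

WHAT. Part 1 (`…TamagawaRoadMordellWeilBrick`) proves `∏_T [𝓖_w : 𝓚_w] · #B ∣ #H¹_𝓖` for any subgroup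
`B` of `T`-locally trivial `p^m`-Selmer classes and supplies `B = κ_{p^m}(E(K))`. THIS FILE is the
`W`-coordinate twist level, word for word g4's
`prod_pow_padicValNat_localTamagawaNumber_dvd_natCard_localPreimage_inf_torsionBy` (p513046 §2: ctrl's
refined tower structure `𝓖 = 𝓣[v₀ ↦ 𝓣_{v₀} ⊓ 𝓚_{v₀}]`, membership by (L0⁺) = Kobayashi (9.33), level
bridge `#H¹_𝓖 = #A₀⁺[p^m]`, local factors `[𝓣_ℓ : 𝓚_ℓ] = p^{ord_p c_ℓ}`) with the new brick and
`B = κ_{p^m}(W(ℚ))`: for the `p*`-partner `W` of a globally minimal good `a_p = 0` curve `V` (`p` odd,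
`κ` cyclotomic, `hPT`), `T ∌ (p)` ⊇ every `ℓ ≠ p` with `p ∣ c_ℓ(W)`, `ord_p c_ℓ(W) ≤ m` on `T`, and the
NEW displayed hypothesis **`hdivT`: the Kummer class `κ_{p^m}(P)` of every rational point `P` of `W` localises to
`0` at every `w ∈ T`** — equivalently (`ker κ_{p^m,w} = p^m W(ℚ_w)`, part 1
`localization_kummerMapTorsion_eq_zero_of_divisible`) every rational point is `p^m`-divisible in
`W(ℚ_w)`:
**`∏_{ℓ ∈ T} p^{ord_p c_ℓ(W)} · #κ_{p^m}(W(ℚ)) ∣ #Sel^{loc,∞,+}(W/ℚ)[p^m]`**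
(`prod_pow_padicValNat_localTamagawaNumber_mul_natCard_kummer_dvd_natCard_localPreimage_inf_torsionBy`).
At a split multiplicative `ℓ ∈ T` with `p ∤ ℓ(ℓ − 1)`, `hdivT` says that every rational point meets
`Φ_ℓ(𝔽_ℓ)` in a component of order prime to `p` (evidence per row: kit j275435 — TRUE on 19601's
rank-one tower-onto row `499800hw1`@7, FALSE on g4's 13 Tamagawa-`5` rows).

PROOF ENGINEERING (§4a). The tree's Kummer maps are elaborated for a general field with the CLASSICAL
`DecidableEq` on coordinates; over `ℚ` the computable one gives a second (propositionally equal) group law on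
`W(ℚ)`. The `ℚ`-statements therefore use `Set.range κ` / `κ P` and `hdivT` in its cohomological form, the
subgroup `κ.range` entering only through part 1's general lemmas (no instance is declared or overridden).

HONEST FRAMING (cell `bsd-potss`, run/shared/lean/pub/bsd-potss/; FULL-BSD rank ≤ 1 programme, HUMAN
RULING D-0036/D-0074): TOOL THEOREMS ONLY — no definition, no named Literature fact minted, no `sorry`,
axioms standard; the crux 19601 (class-wide Eisenstein inclusion at `η`) is OPEN and NOT closed; no row
is certified by this file; nothing is booked; `BSD(W, p)` is claimed for no pair.
`--supports stmt-BirchSwinnertonDyer-19601` (seat `bsd-potss-k8eta-c1`, gen 5). CONDITIONAL on `hPT` and the displayed `hdivT`.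

References: [GreenbergLNM1716] §3 Lemma 3.1–3.3 (pp. 85–90), §4 (pp. 98–103); [Kobayashi2003] Thm. 9.3
with (9.33) (pp. 26–27); [MilneADT2006] I Thm. 4.10; [Howard2004HeegnerKolyvagin] Thm. 2.1.11;
[SilvermanAEC2009] VIII.§2, X.§4 (**).
-/


set_option autoImplicit false
set_option linter.dupNamespace false

noncomputable section

open scoped Classical AddSubgroup

open CategoryTheory Field Function NumberField IsDedekindDomain WeierstrassCurve CongruenceSubgroup
open Literature.NumberTheory.EllipticCurves
open Literature.NumberTheory.EllipticCurves.ModularForms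
open Literature.NumberTheory.GaloisRepresentations
open Literature.NumberTheory.GaloisRepresentations.DiscreteGaloisModule (SelmerStructure)
open Literature.NumberTheory.GaloisCohomology
open Literature.NumberTheory.EllipticCurves.IwasawaDual
open Literature.NumberTheory.EllipticCurves.IwasawaAlgebra
open Summit.BirchSwinnertonDyer.Rank1Residual
open Summit.BirchSwinnertonDyer.Rank1Residual.X5.SelfDualCount
open Summit.BirchSwinnertonDyer.Rank1Residual.GaloisImage.CoreRankZero (selmerGroup_mono)
open Summit.BirchSwinnertonDyer.Rank1Residual.Additive.PoitouTateCountingProduct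
open Summit.BirchSwinnertonDyer.Rank1Residual.X11b.Levels
open Summit.BirchSwinnertonDyer.Rank1Residual.X11b
open Summit.BirchSwinnertonDyer.Rank1Residual.Additive
open Summit.BirchSwinnertonDyer.Rank1Residual.Additive.LevelBridge
open Summit.BirchSwinnertonDyer.Rank1Residual.Additive.RankZeroCount
open scoped ContRepresentation

namespace Summit.BirchSwinnertonDyer.BirchSwinnertonDyer.Theorems

namespace TamagawaRoad


/-! ## §4a Reading the Kummer image through `Set.range` (general number field)

Over `ℚ` the computable `DecidableEq ℚ` and the classical one under which the tree's Kummer map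
`kummerMapTorsion` (`Literature/…/KummerMap.lean`) is elaborated give two (propositionally equal)
group laws on `W(ℚ)`; statements over `ℚ` therefore speak of `Set.range κ` and of `κ P` (which carry
the map's own structure) rather than of `κ.range`, and the bookkeeping between the two is done here,
over a general number field. -/

section RangeBookkeeping

variable {K : Type} [Field K] [NumberField K] (W : WeierstrassCurve K) [W.IsElliptic] {n : ℤ}

omit [NumberField K] [W.IsElliptic] in
/-- `#κ_n(W(K))` read on the subgroup `κ_n.range` or on the set `Set.range κ_n` is the same number
(`AddMonoidHom.coe_range`). [folklore] -/
theorem natCard_range_kummerMapTorsion_eq_natCard_setRange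
    (hdiv : ∀ P : geomPoints W, ∃ Q : geomPoints W, n • Q = P) :
    Nat.card (kummerMapTorsion W n hdiv).range = Nat.card (Set.range (kummerMapTorsion W n hdiv)) := by
  rw [← AddMonoidHom.coe_range]
  rfl

/-- **The brick of part 1 for `B = κ_{p^m}(W(K))`, read on `Set.range κ`**: for a Selmer structure
`𝓖 ⊇ 𝓚` enlarging the Kummer structure at `T` and equal to it elsewhere, GRANTED `hPT`, if the Kummer
class of every rational point localises to `0` at every `w ∈ T` then
**`∏_{w ∈ T} [𝓖_w : 𝓚_w] · #κ_{p^m}(W(K)) ∣ #H¹_𝓖`** (part 1 `prod_relIndex_mul_natCard_dvd_natCard_selmerGroup`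
with `B = κ.range ≤ H¹_𝓚`, `range_kummerMapTorsion_le_selmerGroup_kummerSelmerStructure`).
[cite: Howard2004HeegnerKolyvagin, Thm. 2.1.11 (arXiv:1202.6340 p. 6)] [cite: MilneADT2006, I Thm. 4.10] -/
theorem prod_relIndex_mul_natCard_setRange_kummer_dvd_natCard_selmerGroup (p m : ℕ) [hp : Fact p.Prime]
    (hm : 1 ≤ m) (hPT : poitouTate_selmerStructure_duality_real K)
    (T : Finset (HeightOneSpectrum (𝓞 K)))
    (𝓖 : SelmerStructure (W.torsionGaloisModule ((p ^ m : ℕ) : ℤ)))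
    (h𝓖T : ∀ w ∈ T, W.kummerSelmerStructure ((p ^ m : ℕ) : ℤ) (Sum.inr w) ≤ 𝓖 (Sum.inr w))
    (h𝓖off : ∀ v : Place K, (∀ w ∈ T, v ≠ Sum.inr w) →
      𝓖 v = W.kummerSelmerStructure ((p ^ m : ℕ) : ℤ) v)
    (hdiv : ∀ P : geomPoints W, ∃ Q : geomPoints W, ((p ^ m : ℕ) : ℤ) • Q = P)
    (hloc : ∀ w ∈ T, ∀ P : W.toAffine.Point,
      galoisCohomology.localization (W.torsionGaloisModule ((p ^ m : ℕ) : ℤ)) (Sum.inr w) 1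
        (kummerMapTorsion W ((p ^ m : ℕ) : ℤ) hdiv P) = 0) :
    (∏ w ∈ T, (W.kummerSelmerStructure ((p ^ m : ℕ) : ℤ) (Sum.inr w)).relIndex (𝓖 (Sum.inr w))) *
        Nat.card (Set.range (kummerMapTorsion W ((p ^ m : ℕ) : ℤ) hdiv)) ∣
      Nat.card 𝓖.selmerGroup := by
  have h := prod_relIndex_mul_natCard_dvd_natCard_selmerGroup W p m hm hPT T 𝓖 h𝓖T h𝓖off
    (kummerMapTorsion W ((p ^ m : ℕ) : ℤ) hdiv).range
    (range_kummerMapTorsion_le_selmerGroup_kummerSelmerStructure W hdiv)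
    (by rintro _ ⟨P, rfl⟩ w hw; exact hloc w hw P)
  -- `↥κ.range` and `↥(Set.range κ)` are the same subtype (`AddMonoidHom.range` is a `copy` over `Set.range`)
  have e : ↥(kummerMapTorsion W ((p ^ m : ℕ) : ℤ) hdiv).range ≃
      (Set.range (kummerMapTorsion W ((p ^ m : ℕ) : ℤ) hdiv)) :=
    Equiv.subtypeEquivRight (fun _ ↦ AddMonoidHom.mem_range.trans Set.mem_range.symm)
  calc (∏ w ∈ T, (W.kummerSelmerStructure ((p ^ m : ℕ) : ℤ) (Sum.inr w)).relIndex (𝓖 (Sum.inr w))) *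
        Nat.card (Set.range (kummerMapTorsion W ((p ^ m : ℕ) : ℤ) hdiv))
      = (∏ w ∈ T, (W.kummerSelmerStructure ((p ^ m : ℕ) : ℤ) (Sum.inr w)).relIndex (𝓖 (Sum.inr w))) *
        Nat.card ↥(kummerMapTorsion W ((p ^ m : ℕ) : ℤ) hdiv).range := by rw [Nat.card_congr e]
    _ ∣ Nat.card 𝓖.selmerGroup := h

/-- **`#κ_n(W(K)) ≥ p^{m·rank W(K)}` on `Set.range κ_n`** (`n = p^m`): part 1's
`pow_mul_mordellWeilRank_le_natCard_range_kummerMapTorsion` read on the set. [cite: SilvermanAEC2009, VIII.§1–2 and Thm. X.4.2] -/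
theorem pow_mul_mordellWeilRank_le_natCard_setRange_kummerMapTorsion (p m : ℕ) [hp : Fact p.Prime]
    (hdiv : ∀ P : geomPoints W, ∃ Q : geomPoints W, ((p ^ m : ℕ) : ℤ) • Q = P) :
    Finite (Set.range (kummerMapTorsion W ((p ^ m : ℕ) : ℤ) hdiv)) ∧
      p ^ (m * W.mordellWeilRank) ≤ Nat.card (Set.range (kummerMapTorsion W ((p ^ m : ℕ) : ℤ) hdiv)) := by
  obtain ⟨hfin, hle⟩ := pow_mul_mordellWeilRank_le_natCard_range_kummerMapTorsion W p m hdiv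
  refine ⟨?_, ?_⟩
  · rw [← AddMonoidHom.coe_range]
    exact hfin
  · rwa [natCard_range_kummerMapTorsion_eq_natCard_setRange] at hle

end RangeBookkeeping

/-! ## §4 The `p*`-twist with the Mordell–Weil classes:
`∏_T p^{ord_p c_ℓ(W)} · #κ_{p^m}(W(ℚ)) ∣ #Sel^{loc,∞,+}(W/ℚ)[p^m]` -/

section Twist

open Literature.NumberTheory.EllipticCurves.Kobayashi2003

variable (W : WeierstrassCurve ℚ) [W.IsElliptic] [W.IsGloballyMinimal] (p : ℕ) [hp : Fact p.Prime]
  (κ : ZpExtension ℚ p) (m : ℕ)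

/-- **`∏_{ℓ ∈ T} p^{ord_p c_ℓ(W)} · #κ_{p^m}(W(ℚ)) ∣ #Sel^{loc,∞,+}(W/ℚ)[p^m]` — the Tamagawa lower bound
for the bottom-layer plus control defect WITH the Mordell–Weil classes.** Setting of
`prod_pow_padicValNat_localTamagawaNumber_dvd_natCard_localPreimage_inf_torsionBy` (part 1, p513046):
odd `p`, `W` the `p*`-partner of a globally minimal good `a_p = 0` curve `V`, `κ` cyclotomic, `hPT`,
`T ∌ (p)` ⊇ every `ℓ ≠ p` with `p ∣ c_ℓ(W)`, `ord_p c_ℓ(W) ≤ m` on `T` (`m ≥ 1`); NEW: `hdivT` — every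
Kummer class `κ_{p^m}(P)`, `P ∈ W(ℚ)`, localises to `0` at `T` (⟸ `P` is `p^m`-divisible in `W(ℚ_w)`:
`loc_w κ_{p^m}(P) = κ_{p^m,w}(P_w)`, tree `res_kummerMapTorsion_eq_localKummerMap`, and
`ker κ_{p^m,w} = p^m W(ℚ_w)`, tree `ker_localKummerMap` — part 1
`localization_kummerMapTorsion_eq_zero_of_divisible`). The classes lie in `Sel^{(p^m)}(W/ℚ) = H¹_𝓚`, so §2 applies with `B = κ_{p^m}(W(ℚ))` to
ctrl's refined tower structure `𝓖 = 𝓣[v₀ ↦ 𝓣_{v₀} ⊓ 𝓚_{v₀}]` exactly as in part 1 (membership by (L0⁺),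
level bridge `#H¹_𝓖 = #A₀⁺[p^m]`, local factors `[𝓣_ℓ : 𝓚_ℓ] = p^{ord_p c_ℓ}`). CONDITIONAL on `hPT`;
nothing booked. [cite: GreenbergLNM1716, §3 Lemma 3.1–3.3 (pp. 85–90), §4 (pp. 98–103)]
[cite: Kobayashi2003, Thm. 9.3 with (9.33) (pp. 26–27)] [cite: MilneADT2006, Ch. I, Thm. 4.10]
[cite: Howard2004HeegnerKolyvagin, Thm. 2.1.11 (arXiv:1202.6340 p. 6)] [cite: SilvermanAEC2009, X.§4 diagram (**)] -/
theorem prod_pow_padicValNat_localTamagawaNumber_mul_natCard_kummer_dvd_natCard_localPreimage_inf_torsionBy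
    (hm : 1 ≤ m) (hp2 : p ≠ 2) (hκ : κ.IsCyclotomic) (Cv : VariableChange ℚ) (V : WeierstrassCurve ℚ)
    [V.IsElliptic] [V.IsGloballyMinimal] (hCV : Cv • W.quadraticTwist ((-1) ^ (p / 2) * p) = V)
    (hgood : V.HasGoodReductionAtPrime p) (hap : V.frobeniusTrace p = 0)
    (hPT : poitouTate_selmerStructure_duality_real ℚ)
    (T : Finset (HeightOneSpectrum (𝓞 ℚ)))
    (hpT : (Rat.HeightOneSpectrum.primesEquiv (R := 𝓞 ℚ)).symm ⟨p, hp.out⟩ ∉ T)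
    (hT : ∀ v : HeightOneSpectrum (𝓞 ℚ), v ≠ (Rat.HeightOneSpectrum.primesEquiv (R := 𝓞 ℚ)).symm ⟨p, hp.out⟩ →
      p ∣ (W.baseChange (v.adicCompletion ℚ)).localTamagawaNumber (v.adicCompletionIntegers ℚ) → v ∈ T)
    (hTm : ∀ w ∈ T, padicValNat p ((W.baseChange (w.adicCompletion ℚ)).localTamagawaNumber
      (w.adicCompletionIntegers ℚ)) ≤ m)
    (hdiv : ∀ P : geomPoints W, ∃ Q : geomPoints W, ((p ^ m : ℕ) : ℤ) • Q = P)
    (hdivT : ∀ w ∈ T, ∀ P : W.toAffine.Point,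
      galoisCohomology.localization (W.torsionGaloisModule ((p ^ m : ℕ) : ℤ)) (Sum.inr w) 1
        (kummerMapTorsion W ((p ^ m : ℕ) : ℤ) hdiv P) = 0) :
    (∏ w ∈ T, p ^ padicValNat p ((W.baseChange (w.adicCompletion ℚ)).localTamagawaNumber
        (w.adicCompletionIntegers ℚ))) * Nat.card (Set.range (kummerMapTorsion W ((p ^ m : ℕ) : ℤ) hdiv)) ∣
      Nat.card ↥((W.selmerInfty κ ⊓ ⨅ σ : absoluteGaloisGroup ℚ,
          (localKummerOverOfEmb W p κ.kerSubgroup (closureEmb (K := ℚ) ℚ_[p])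
            (⨆ n, strictSignedLocalPoints κ ℚ_[p] W 1 n)).comap
              (W.conjH1 p κ.kerSubgroup σ)).comap (W.layerToInfty κ 0) ⊓
        AddSubgroup.torsionBy (W.subgroupH1 p (κ.layerSubgroup 0)) ((p ^ m : ℕ) : ℤ)) := by
  set v₀ := (Rat.HeightOneSpectrum.primesEquiv (R := 𝓞 ℚ)).symm ⟨p, hp.out⟩ with hv₀def
  have hn0 : ((p ^ m : ℕ) : ℤ) ≠ 0 := Nat.cast_ne_zero.mpr (pow_ne_zero m hp.out.ne_zero)
  -- abbreviations
  set 𝓚 : SelmerStructure (W.torsionGaloisModule ((p ^ m : ℕ) : ℤ)) :=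
    W.kummerSelmerStructure ((p ^ m : ℕ) : ℤ) with h𝓚def
  set Sig : AddSubgroup (W.subgroupH1 p (κ.layerSubgroup 0)) := (⨅ σ : absoluteGaloisGroup ℚ,
    (localKummerOverOfEmb W p κ.kerSubgroup (closureEmb (K := ℚ) ℚ_[p])
      (⨆ n, strictSignedLocalPoints κ ℚ_[p] W 1 n)).comap (W.conjH1 p κ.kerSubgroup σ)).comap
    (W.layerToInfty κ 0) with hSig
  set A₀ : AddSubgroup (W.subgroupH1 p (κ.layerSubgroup 0)) := (W.selmerInfty κ ⊓
      ⨅ σ : absoluteGaloisGroup ℚ,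
        (localKummerOverOfEmb W p κ.kerSubgroup (closureEmb (K := ℚ) ℚ_[p])
          (⨆ n, strictSignedLocalPoints κ ℚ_[p] W 1 n)).comap
            (W.conjH1 p κ.kerSubgroup σ)).comap (W.layerToInfty κ 0) with hA₀
  have hA₀eq : A₀ = W.selmerInftyPreimage κ 0 ⊓ Sig := by
    rw [hA₀, AddSubgroup.comap_inf]
    rfl
  set A' : AddSubgroup (W.subgroupH1 p (κ.layerSubgroup 0)) :=
    A₀ ⊓ AddSubgroup.torsionBy (W.subgroupH1 p (κ.layerSubgroup 0)) ((p ^ m : ℕ) : ℤ) with hA'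
  -- places: `p ∈ w ↔ w = v₀`
  have hpw : ∀ w : HeightOneSpectrum (𝓞 ℚ), w ≠ v₀ → (p : 𝓞 ℚ) ∉ w.asIdeal := fun w hw h ↦
    hw ((natCast_mem_asIdeal_iff_eq_primesEquiv_symm w hp.out).mp h)
  have hpT' : ∀ w ∈ T, (p : 𝓞 ℚ) ∉ w.asIdeal := fun w hw ↦ hpw w fun h ↦ hpT (h ▸ hw)
  -- (Γ) `W[p^∞]^{Γ_ℚ} = 0` from `W[p^∞]^{Gal(ℚ̄/ℚ_∞)} = 0` (x1b file 55), and divisibility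
  obtain ⟨M₀, hΔ, hA, hVM₀⟩ := exists_goodSupersingularPadicModel hp2 V hgood hap
  have hc := sq_ne_neg_one_pow_mul_prime hp.out (p / 2)
  have hΓ : ∀ Q : W.geomPrimaryTorsion p,
      (∀ σ : absoluteGaloisGroup ℚ, X11b.LocBridge.primaryGaloisModule W p σ Q = Q) → Q = 0 := by
    intro Q hQ
    have hmem : Q ∈ FixedPoints.addSubgroup κ.kerSubgroup (W.geomPrimaryTorsion p) := by
      rw [FixedPoints.mem_addSubgroup]
      intro σ
      exact hQ σ
    rw [fixedPoints_kerSubgroup_geomPrimaryTorsion_eq_bot_of_quadraticTwist κ hp2 W hc Cv hCV M₀ hΔ hA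
      hVM₀] at hmem
    exact (AddSubgroup.mem_bot).mp hmem
  have hdiv' : W.zsmul_geomPoints_surjective := W.zsmul_geomPoints_surjective_holds
  -- the tower structure `𝓣` on `W[p^m]`, as an explicit term
  let 𝓣 : SelmerStructure (W.torsionGaloisModule ((p ^ m : ℕ) : ℤ)) := fun v ↦
    match v with
    | Sum.inl w => W.kummerSelmerStructure ((p ^ m : ℕ) : ℤ) (Sum.inl w)
    | Sum.inr v => (W.localTowerKer κ (v.adicCompletion ℚ) 0).comap
        ((resH1Hom (Literature.NumberTheory.EllipticCurves.subgroupIncl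
            (localSubgroup (κ.layerSubgroup 0) (v.adicCompletion ℚ)))
          (AddMonoidHom.id (localPoints W (v.adicCompletion ℚ))) (fun _ _ ↦ rfl)).comp
          (galoisCohomology.map
            (W.torsionPointsMapIntertwining ((p ^ m : ℕ) : ℤ) (v.adicCompletion ℚ)) 1))
  have h𝓣fin : ∀ v : HeightOneSpectrum (𝓞 ℚ), 𝓣 (Sum.inr v) =
      (W.localTowerKer κ (v.adicCompletion ℚ) 0).comap
        ((resH1Hom (Literature.NumberTheory.EllipticCurves.subgroupIncl
            (localSubgroup (κ.layerSubgroup 0) (v.adicCompletion ℚ)))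
          (AddMonoidHom.id (localPoints W (v.adicCompletion ℚ))) (fun _ _ ↦ rfl)).comp
          (galoisCohomology.map
            (W.torsionPointsMapIntertwining ((p ^ m : ℕ) : ℤ) (v.adicCompletion ℚ)) 1)) := fun _ ↦ rfl
  have h𝓣inf : ∀ w : InfinitePlace ℚ, 𝓣 (Sum.inl w) = W.kummerSelmerStructure ((p ^ m : ℕ) : ℤ) (Sum.inl w) :=
    fun _ ↦ rfl
  have hT0 : ∀ v : HeightOneSpectrum (𝓞 ℚ), v ∉ T → v ≠ v₀ →
      W.localTowerKerPrimary κ (v.adicCompletion ℚ) 0 = ⊥ := fun v hv hne ↦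
    localTowerKerPrimary_eq_bot_of_not_dvd_localTamagawaNumber W hκ (hpw v hne) fun hd ↦ hv (hT v hne hd)
  -- the structure `𝓖 = 𝓣[v₀ ↦ 𝓣_{v₀} ⊓ 𝓚_{v₀}]`
  set 𝓖 : SelmerStructure (W.torsionGaloisModule ((p ^ m : ℕ) : ℤ)) :=
    Function.update 𝓣 (Sum.inr v₀) (𝓣 (Sum.inr v₀) ⊓ 𝓚 (Sum.inr v₀)) with h𝓖
  -- ctrl's §1 at `v₀`
  have hL1 := localization_mem_kummer_iff_levelToLayerZero_mem_localKummer_zero W p κ m v₀ rfl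
  -- (α) `c ∈ H¹_𝓖 ↔ Ψ_m c ∈ A₀⁺`
  have hiffA : ∀ c, c ∈ 𝓖.selmerGroup ↔
      resH1Hom (Literature.NumberTheory.EllipticCurves.subgroupIncl (κ.layerSubgroup 0)) (AddMonoidHom.id (geomPrimaryTorsion W p))
        (fun _ _ ↦ rfl) (galoisCohomology.map (primaryInclusion W p m) 1 c) ∈ A₀ := by
    intro c
    rw [hA₀eq, h𝓖]
    refine mem_selmerGroup_update_inf_iff_levelToLayerZero_mem_inf W p κ m 𝓣 (W.selmerInftyPreimage κ 0)
      (mem_selmerGroup_iff_levelToLayerZero_mem_selmerInftyPreimage W p κ m 𝓣 h𝓣fin h𝓣inf)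
      (Sum.inr v₀) (𝓚 (Sum.inr v₀)) Sig (fun c hc ↦ ⟨fun h ↦ ?_, fun h ↦ ?_⟩) c
    · exact mem_plusSig_of_mem_localKummer_zero W p κ _ ((hL1 c).mp h)
    · refine (hL1 c).mpr (evenBranchPlusLocalControlZeroAt_holds W p V Cv hp2 hCV hgood hap κ hκ _ ?_)
      rw [AddSubgroup.comap_inf]
      exact ⟨hc, h⟩
  -- (α') `c ∈ H¹_𝓖 ↔ Ψ_m c ∈ A₀⁺[p^m]` (every `Ψ_m c` is killed by `p^m`)
  have hiffA' : ∀ c, c ∈ 𝓖.selmerGroup ↔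
      resH1Hom (Literature.NumberTheory.EllipticCurves.subgroupIncl (κ.layerSubgroup 0)) (AddMonoidHom.id (geomPrimaryTorsion W p))
        (fun _ _ ↦ rfl) (galoisCohomology.map (primaryInclusion W p m) 1 c) ∈ A' := by
    intro c
    rw [hiffA c, hA', AddSubgroup.mem_inf, AddSubgroup.torsionBy.nsmul_iff]
    exact ⟨fun h ↦ ⟨h, pow_smul_levelToLayerZero_eq_zero W p κ m c⟩, fun h ↦ h.1⟩
  have hA'm : ∀ z ∈ A', p ^ m • z = 0 := fun z hz ↦
    AddSubgroup.torsionBy.nsmul_iff.mp (AddSubgroup.mem_inf.mp hz).2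
  -- `𝓖 ⊇ 𝓚` at `T`, `𝓖 = 𝓚` off `T`
  have hv₀ne : ∀ w ∈ T, (Sum.inr w : Place ℚ) ≠ Sum.inr v₀ := fun w hw h ↦
    hpT ((Sum.inr_injective h) ▸ hw)
  have h𝓖T : ∀ w ∈ T, 𝓚 (Sum.inr w) ≤ 𝓖 (Sum.inr w) := fun w hw ↦ by
    rw [h𝓖, Function.update_of_ne (hv₀ne w hw), h𝓣fin w]
    exact kummerSelmerStructure_inr_le_comap_localTowerKer W p κ m w
  have h𝓖eqT : ∀ w ∈ T, 𝓖 (Sum.inr w) = 𝓣 (Sum.inr w) := fun w hw ↦ by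
    rw [h𝓖, Function.update_of_ne (hv₀ne w hw)]
  have h𝓖off : ∀ v : Place ℚ, (∀ w ∈ T, v ≠ Sum.inr w) → 𝓖 v = 𝓚 v := by
    intro v hv
    by_cases hv0 : v = Sum.inr v₀
    · subst hv0
      rw [h𝓖, Function.update_self, inf_eq_right, h𝓣fin v₀]
      exact kummerSelmerStructure_inr_le_comap_localTowerKer W p κ m v₀
    · rw [h𝓖, Function.update_of_ne hv0]
      refine eq_kummerSelmerStructure_of_not_mem W p κ m 𝓣 h𝓣fin h𝓣inf (↑T ∪ {v₀}) (fun v' hv' ↦ ?_) v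
        (fun w hw ↦ ?_)
      · simp only [Set.mem_union, Finset.mem_coe, Set.mem_singleton_iff, not_or] at hv'
        exact hT0 v' hv'.1 hv'.2
      · rcases hw with hw | hw
        · exact hv w hw
        · rw [Set.mem_singleton_iff.mp hw]; exact hv0
  -- the Mordell–Weil classes `B = κ_{p^m}(W(ℚ))`: in `H¹_𝓚`, and `T`-locally trivial by `hdivT` (the subgroup
  -- `κ.range` is taken from part 1's general lemmas, which carry the Kummer map's own group law on `W(ℚ)`)
  -- §2 (part 1's brick for `B = κ.range`, §4a) and the level bridge `#H¹_𝓖 = #A₀⁺[p^m]`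
  have hcount := prod_relIndex_mul_natCard_setRange_kummer_dvd_natCard_selmerGroup W p m hm hPT T 𝓖 h𝓖T
    h𝓖off hdiv hdivT
  rw [natCard_selmerGroup_eq_of_iff W p κ m hdiv' hΓ 𝓖 A' hA'm hiffA'] at hcount
  -- the local factors (x1b file 75, B4)
  have hloc : ∀ w ∈ T, (W.kummerSelmerStructure ((p ^ m : ℕ) : ℤ) (Sum.inr w)).relIndex (𝓖 (Sum.inr w)) =
      p ^ padicValNat p ((W.baseChange (w.adicCompletion ℚ)).localTamagawaNumber
        (w.adicCompletionIntegers ℚ)) := fun w hw ↦ by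
    obtain ⟨δ, hδ⟩ := Greenberg1999.exists_apply_resGal_ne_one_of_isCyclotomic hκ w
    rw [h𝓖eqT w hw]
    exact relIndex_kummer_comap_localTowerKer_eq_pow_padicValNat_localTamagawaNumber W p κ m (hpT' w hw)
      ⟨δ, fun h ↦ hδ (ZpExtension.mem_kerSubgroup.mp h)⟩ (hTm w hw)
  rw [Finset.prod_congr rfl hloc] at hcount
  rw [hA', hA₀] at hcount
  exact hcount

end Twist

end TamagawaRoad

end Summit.BirchSwinnertonDyer.BirchSwinnertonDyer.Theorems

end
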